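import Literature.NumberTheory.GaloisCohomology.RestrictedRamificationCdTwoOfH3Mu
import Literature.NumberTheory.GaloisCohomology.RestrictedRamificationH3MuOfFinite
import Literature.NumberTheory.GaloisCohomology.RestrictedRamificationH3MuOfSUnits
import Literature.NumberTheory.GaloisRepresentations.SUnitsRestrictedLayers
import HarnessLib

/-!
# Harari Cor. 17.14 / Thm. 17.13 (a) (totally complex `K`) FROM the cohomology of the `S`-units at
# FINITE `S`: `p · H²(U, E_S) = H²(U, E_S)` and `H³(U, E_S)[p] = 0` (NSW (8.3.11) (iii), (iv) ⟹ (8.3.18))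

Topic `NumberTheory/GaloisCohomology`; namespace `Literature.NumberTheory.GaloisCohomology`.
THEOREMS ONLY (no definition, no named fact, no instance, no `sorry`; D-0026).

The END-INTERFACE of lane «PT3-TC» (cell `bsd-eis`, crux `GoodLatticeBDPValue`,
stmt-BirchSwinnertonDyer-19032): composing
* (R) `groupCdLE_two_galoisGroupUnramifiedOutside_of_forall_H3_mu` /
  `poitouTate_restricted_three_le_of_forall_H3_mu` ((H3μ)_K ⟹ the two named facts),
* (LIM) `forall_subsingleton_continuousCohomology_mu_of_finite` ((H3μ) at the finite `S ⊇ S_p` ⟹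
  at every `S ⊇ S_p`; `K_S = ⋃ K_{S′}`), and
* (A5-α) `subsingleton_H3_mu_of_sUnits` (`H³(U, μ_p) = 0` from the Kummer sequence of `E_S|_U`),
the textbook named facts `groupCdLE_two_galoisGroupUnramifiedOutside K` (Harari Cor. 17.14 = NSW
(8.3.18)) and, at a totally complex `K`, `poitouTate_restricted_three_le K` (Harari Thm. 17.13 (a))
follow from ONE arithmetic hypothesis on the `S`-units `E_S = 𝒪_{K_S,S}ˣ` at FINITE `S`:

> **(E)_K**: for every finite `S ∋ (v ∣ p)` (`p ≠ 2` if `K` has a real place) and every OPEN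
> `H ≤ Γ_K` containing `N_S` (`U := galoisGroupAbove S H = H/N_S ≤ G_{K,S}`, `F₀ = K̄^H ⊆ K_S`), with
> `D := E_S|_U = SUnits.Layers.resRep K S H` (brick (A2-β2)): (iii) every class of `H²(U, D)` is
> divisible by `p`; (iv) `H³(U, D)` has no `p`-torsion — Neukirch–Schmidt–Wingberg (8.3.11) (iii)
> `H²(G_S(F₀), 𝒪_S^×)(p)` divisible, (iv) `H³(G_S(F₀), 𝒪_S^×)(p) = 0`, for the finite `F₀/K` in `K_S`.
> This is VERBATIM the output shape of the (A2-β2) discharge («(A4-iii)/(A4-iv) at all layers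
> `E ≥ baseField H` ⟹ (iii), (iv) for `resRep K S H`»); every open `U ≤ G_{K,S}` is such a
> `galoisGroupAbove S H` (`H` = preimage of `U`), which is how the composition consumes it.

* `groupCdLE_two_galoisGroupUnramifiedOutside_of_sUnits_cohomology : (E)_K → groupCdLE_two_… K`;
* `poitouTate_restricted_three_le_of_sUnits_cohomology [IsTotallyComplex K] : (E)_K → poitouTate_restricted_three_le K`
  (real-place clause dropped).

So the lane's last brick (A5) is exactly a proof of (E)_K (from the `S`-idèle class formation at the
finite layers: bricks (A2)/(A3a–d)/(β2)).  HONEST FRAMING: composition only; (E)_K is a hypothesis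
here; no case of Harari 17.13 (a) / 17.14 or of BSD is proved in this file.

## References
* J. Neukirch, A. Schmidt, K. Wingberg, *Cohomology of Number Fields*, 2nd ed. (2008), (8.3.11)
  (iii)–(iv), (8.3.18) and its proof. [NeukirchSchmidtWingberg2008]
* D. Harari, *Galois Cohomology and Class Field Theory* (2020), Thm. 17.13 (a), Cor. 17.14,
  Lemma 17.21 (a). [Harari2020]
-/

noncomputable section

open CategoryTheory Function NumberField Field IsDedekindDomain Topology
open scoped NumberField

namespace Literature.NumberTheory.GaloisCohomology

open Literature.NumberTheory.GaloisRepresentations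
open Literature.NumberTheory.GaloisRepresentations.DiscreteGaloisModule (mu MuCarrier)
open Literature.NumberTheory.GaloisRepresentations.SUnits
open Literature.NumberTheory.IwasawaTheory.Greenberg2006 (galoisGroupAbove)
open _root_.TopRep _root_.ContRepresentation _root_.ContinuousCohomology

variable {K : Type} [Field K] [NumberField K]

/-- **Harari Cor. 17.14 / NSW (8.3.18) `cd_p(G_{K,S}) ≤ 2` for `K`, FROM the cohomology of the
`S`-units at finite `S`** (hypothesis (E)_K of the module docstring: for every finite `S ∋ (v ∣ p)`,
`p ≠ 2` if `K` has a real place, and every open `H ≤ Γ_K` above `N_S`, with `U = galoisGroupAbove S H`,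
`p · H²(U, E_S|_U) = H²(U, E_S|_U)` and `H³(U, E_S|_U)[p] = 0`, `E_S|_U = SUnits.Layers.resRep K S H`).
Composition (R) ∘ (LIM) ∘ (A5-α) of the lane; an arbitrary open `U ≤ G_{K,S}` is rewritten as
`galoisGroupAbove S (π⁻¹ U)` (`Subgroup.map_comap_eq_self_of_surjective`).
[cite: NeukirchSchmidtWingberg2008, (8.3.11) (iii)–(iv), proof of (8.3.18)] [cite: Harari2020, Cor. 17.14] -/
theorem groupCdLE_two_galoisGroupUnramifiedOutside_of_sUnits_cohomology
    (h : ∀ (S : Set (HeightOneSpectrum (𝓞 K))) (p : ℕ) [Fact p.Prime], S.Finite →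
      (∀ v : HeightOneSpectrum (𝓞 K), ((p : ℕ) : 𝓞 K) ∈ v.asIdeal → v ∈ S) →
      ((∃ w : InfinitePlace K, w.IsReal) → p ≠ 2) →
      ∀ (H : Subgroup (absoluteGaloisGroup K)), IsOpen (H : Set (absoluteGaloisGroup K)) →
        ramificationSubgroup K S ≤ H →
        (∀ y : continuousCohomology 2 (SUnits.Layers.resRep K S H).toTopRep,
          ∃ z : continuousCohomology 2 (SUnits.Layers.resRep K S H).toTopRep, p • z = y) ∧
        (∀ y : continuousCohomology 3 (SUnits.Layers.resRep K S H).toTopRep, p • y = 0 → y = 0)) :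
    groupCdLE_two_galoisGroupUnramifiedOutside K :=
  groupCdLE_two_galoisGroupUnramifiedOutside_of_forall_H3_mu fun S p _ hSp hreal ρ₀ hρ₀ U hU hfix =>
    forall_subsingleton_continuousCohomology_mu_of_finite 3
      (fun S' p' _ hS'f hS'p hreal' ρ₀' hρ₀' U' hU' hfix' => by
        -- `U' = galoisGroupAbove S' H` for the open `H := π⁻¹(U') ⊇ N_{S'}`
        obtain ⟨H, hHo, hNS, rfl⟩ : ∃ H : Subgroup (absoluteGaloisGroup K),
            IsOpen (H : Set (absoluteGaloisGroup K)) ∧ ramificationSubgroup K S' ≤ H ∧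
              galoisGroupAbove S' H = U' :=
          ⟨U'.comap (toUnramifiedQuot K S'), hU'.preimage (continuous_toUnramifiedQuot K S'),
            fun σ hσ => by
              rw [Subgroup.mem_comap]
              have h1 : toUnramifiedQuot K S' σ = 1 := (QuotientGroup.eq_one_iff σ).2 hσ
              rw [h1]
              exact U'.one_mem,
            Subgroup.map_comap_eq_self_of_surjective (toUnramifiedQuot_surjective K S') U'⟩
        exact subsingleton_H3_mu_of_sUnits S' p' hS'p ρ₀' hρ₀' (galoisGroupAbove S' H) hU' hfix'
          (h S' p' hS'f hS'p hreal' H hHo hNS).1 (h S' p' hS'f hS'p hreal' H hHo hNS).2)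
      S p hSp hreal ρ₀ hρ₀ U hU hfix

/-- **Harari Thm. 17.13 (a) at a TOTALLY COMPLEX `K`, FROM the cohomology of the `S`-units at finite
`S`** (hypothesis (E)_K, the real-place clause being vacuous): the named fact
`poitouTate_restricted_three_le K`.  Composition (R) ∘ (LIM) ∘ (A5-α); this is the statement lane
«PT3-TC» delivers to the BSD routes once (E)_K is proved (brick (A5)).
[cite: Harari2020, Thm. 17.13 (a), Cor. 17.14] [cite: NeukirchSchmidtWingberg2008, (8.3.11) (iii)–(iv), (8.3.18)] -/
theorem poitouTate_restricted_three_le_of_sUnits_cohomology [IsTotallyComplex K]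
    (h : ∀ (S : Set (HeightOneSpectrum (𝓞 K))) (p : ℕ) [Fact p.Prime], S.Finite →
      (∀ v : HeightOneSpectrum (𝓞 K), ((p : ℕ) : 𝓞 K) ∈ v.asIdeal → v ∈ S) →
      ∀ (H : Subgroup (absoluteGaloisGroup K)), IsOpen (H : Set (absoluteGaloisGroup K)) →
        ramificationSubgroup K S ≤ H →
        (∀ y : continuousCohomology 2 (SUnits.Layers.resRep K S H).toTopRep,
          ∃ z : continuousCohomology 2 (SUnits.Layers.resRep K S H).toTopRep, p • z = y) ∧
        (∀ y : continuousCohomology 3 (SUnits.Layers.resRep K S H).toTopRep, p • y = 0 → y = 0)) :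
    poitouTate_restricted_three_le K :=
  poitouTate_restricted_three_le_of_groupCdLE_two
    (groupCdLE_two_galoisGroupUnramifiedOutside_of_sUnits_cohomology
      fun S p _ hSf hSp _ H hHo hNS => h S p hSf hSp H hHo hNS)

end Literature.NumberTheory.GaloisCohomology

end
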